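import Literature.RepresentationTheory.HeisenbergGroup.ImplementerCocycle
import Mathlib.Topology.Algebra.OpenSubgroup
import HarnessLib

/-!
# The genuine representation `ω = β⁻¹ · (r ∘ ι)` of a split subgroup and its stabilisers

[cite: MoeglinVignerasWaldspurger1987, Chap. 2 II.1, II.8; Kudla1994, Thm 3.1; HarrisKudlaSweet1996, §1 (1.14)]

For a model `ρ` of the Heisenberg group with a normalised section of implementers `r` (multiplier `c_r`), a
homomorphism `ι : H →* Sp(B)` and a function `β : H → kˣ` splitting `c_r ∘ ι` (`β(g₁g₂) c_r(ιg₁, ιg₂) = β(g₁) β(g₂)`,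
Kudla's `β_χ`), the operators `ω(g) = β(g)⁻¹ r(ι g)` form a GENUINE representation of `H` (`omega_mul`, `omega_one`).
Hence the stabiliser `{g | ω(g) f = f}` of a vector is a subgroup (`omegaStabilizer`), open as soon as it is a
neighbourhood of `1` (`isOpen_omegaStabilizer_of_mem_nhds`), and a neighbourhood of `1` as soon as every element of
some neighbourhood factors as `p · (w₀ n w₀⁻¹)` with `ω(p) f = f` and `ω(n)` fixing `ω(w₀)⁻¹ f`
(`omegaStabilizer_mem_nhds_of_factorisation`) — the group-theoretic skeleton of the smoothness of the Weil
representation restricted to a member of a dual pair via an Iwahori factorisation (MVW Chap. 2 II.8).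
-/

set_option autoImplicit false

noncomputable section

namespace Literature.RepresentationTheory.HeisenbergGroup

namespace ImplementerSection

open scoped Topology

universe u v u' v'

variable {R : Type u} [CommRing R] [Invertible (2 : R)] {V : Type v} [AddCommGroup V] [Module R V]
  {B : V →ₗ[R] V →ₗ[R] R}
variable {k : Type u'} [Field k] {S : Type v'} [AddCommGroup S] [Module k S] [Nontrivial S]
variable {ρ : Representation k (Heisenberg B) S} (r : ImplementerSection ρ) (hU : ImplementerUniqueUpToScalar ρ)
variable {H : Type*} [Group H] (ι : H →* symplecticGroup B) (β : H → kˣ)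

/-- **`ω(g) f = β(g)⁻¹ · r(ι g) f`**. [cite: Kudla1994, Thm 3.1; HarrisKudlaSweet1996, §1 (1.14)] -/
def omega (g : H) (f : S) : S := ((β g)⁻¹ : kˣ) • r (ι g) f

omit [Nontrivial S] in
/-- unfolding. [cite: Kudla1994, Thm 3.1] -/
theorem omega_apply (g : H) (f : S) : r.omega ι β g f = ((β g)⁻¹ : kˣ) • r (ι g) f := rfl

variable {β}
variable (hβ : ∀ g₁ g₂ : H, β (g₁ * g₂) * r.cocycle hU (ι g₁) (ι g₂) = β g₁ * β g₂)
include hβ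

/-- a splitting function is normalised: `β(1) = 1`. [cite: Kudla1994, Thm 3.1] -/
theorem beta_one_of_split : β 1 = 1 := by
  have h := hβ 1 1
  rw [mul_one, ι.map_one, r.cocycle_one_left hU, mul_one] at h
  exact (mul_eq_left.mp h.symm)

/-- `ω(1) = id`. [cite: MoeglinVignerasWaldspurger1987, Chap. 2 II.1] -/
theorem omega_one (f : S) : r.omega ι β 1 f = f := by
  rw [omega_apply, r.beta_one_of_split hU ι hβ, inv_one, one_smul, ι.map_one]
  change ((r 1 : S ≃ₗ[k] S) : Module.End k S) f = f
  rw [r.coe_map_one]; rfl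

/-- **`ω` is multiplicative**: `ω(g₁ g₂) = ω(g₁) ∘ ω(g₂)` — the multiplier of `r ∘ ι` is exactly absorbed by `β`.
[cite: MoeglinVignerasWaldspurger1987, Chap. 2 II.1; Kudla1994, Thm 3.1] -/
theorem omega_mul (g₁ g₂ : H) (f : S) : r.omega ι β (g₁ * g₂) f = r.omega ι β g₁ (r.omega ι β g₂ f) := by
  simp only [omega_apply, Units.smul_def, map_smul, map_mul, r.mul_apply hU, smul_smul]
  congr 1
  have h : (β (g₁ * g₂))⁻¹ = (β g₁)⁻¹ * (β g₂)⁻¹ * r.cocycle hU (ι g₁) (ι g₂) := by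
    rw [eq_mul_inv_of_mul_eq (hβ g₁ g₂), mul_inv, mul_inv, inv_inv]
  rw [h, Units.val_mul, Units.val_mul, r.cocycle_apply, mul_assoc]

/-- `ω(g⁻¹) (ω(g) f) = f`. [cite: MoeglinVignerasWaldspurger1987, Chap. 2 II.1] -/
theorem omega_inv_apply (g : H) (f : S) : r.omega ι β g⁻¹ (r.omega ι β g f) = f := by
  rw [← r.omega_mul hU ι hβ, inv_mul_cancel, r.omega_one hU ι hβ]

/-- `ω(g) (ω(g⁻¹) f) = f`. [cite: MoeglinVignerasWaldspurger1987, Chap. 2 II.1] -/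
theorem omega_apply_inv (g : H) (f : S) : r.omega ι β g (r.omega ι β g⁻¹ f) = f := by
  rw [← r.omega_mul hU ι hβ, mul_inv_cancel, r.omega_one hU ι hβ]

/-- **the stabiliser of a vector under `ω`**, a subgroup of `H`. [cite: MoeglinVignerasWaldspurger1987, Chap. 2 II.8] -/
def omegaStabilizer (f : S) : Subgroup H where
  carrier := {g | r.omega ι β g f = f}
  mul_mem' {a b} ha hb := by
    change r.omega ι β (a * b) f = f
    rw [r.omega_mul hU ι hβ, hb, ha]
  one_mem' := r.omega_one hU ι hβ f
  inv_mem' {a} ha := by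
    change r.omega ι β a⁻¹ f = f
    conv_lhs => rw [← ha]
    exact r.omega_inv_apply hU ι hβ a f

/-- membership. [cite: MoeglinVignerasWaldspurger1987, Chap. 2 II.8] -/
theorem mem_omegaStabilizer_iff (f : S) (g : H) : g ∈ r.omegaStabilizer hU ι hβ f ↔ r.omega ι β g f = f := Iff.rfl

/-- a subgroup that is a neighbourhood of `1` is open. [cite: MoeglinVignerasWaldspurger1987, Chap. 2 II.8] -/
theorem isOpen_omegaStabilizer_of_mem_nhds [TopologicalSpace H] [IsTopologicalGroup H] (f : S)
    (h : (r.omegaStabilizer hU ι hβ f : Set H) ∈ 𝓝 (1 : H)) : IsOpen (r.omegaStabilizer hU ι hβ f : Set H) :=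
  Subgroup.isOpen_of_mem_nhds _ h

/-- **reduction of smoothness to an Iwahori-type factorisation**: if every `k` in a neighbourhood of `1` factors as
`k = p · (w₀ n w₀⁻¹)` with `ω(p) f = f` and `ω(n) (ω(w₀)⁻¹ f) = ω(w₀)⁻¹ f`, then the stabiliser of `f` is a
neighbourhood of `1`. [cite: MoeglinVignerasWaldspurger1987, Chap. 2 II.8] -/
theorem omegaStabilizer_mem_nhds_of_factorisation [TopologicalSpace H] (f : S) {U : Set H} (hU1 : U ∈ 𝓝 (1 : H))
    (w₀ : H) (hfac : ∀ x ∈ U, ∃ p n : H, x = p * (w₀ * n * w₀⁻¹) ∧ r.omega ι β p f = f ∧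
      r.omega ι β n (r.omega ι β w₀⁻¹ f) = r.omega ι β w₀⁻¹ f) :
    (r.omegaStabilizer hU ι hβ f : Set H) ∈ 𝓝 (1 : H) := by
  refine Filter.mem_of_superset hU1 fun x hx => ?_
  obtain ⟨p, n, rfl, hp, hn⟩ := hfac x hx
  change r.omega ι β (p * (w₀ * n * w₀⁻¹)) f = f
  rw [r.omega_mul hU ι hβ, r.omega_mul hU ι hβ, r.omega_mul hU ι hβ, hn, r.omega_apply_inv hU ι hβ, hp]

end ImplementerSection

end Literature.RepresentationTheory.HeisenbergGroup

end
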